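import Summits.KontsevichZagierPeriods.KontsevichZagierPeriods.Theorems.SymplecticScissorsVolumeFormOffPlaneLogBoxCut
import Literature.MeasureTheory.Lebesgue.PolynomialZeroSet

/-!
# `VolumeFormOffPlane` (stmt-KontsevichZagierPeriods-14935) — line `Sketch`,
stub `stub_squareSplit` (splitting the log-square along the hyperbola `xy = g`)

Dimension `3`, coordinates `x = p 0`, `y = p 1` and slack `z = p 2` subject to
`0 < z ∧ z · (x · y) < 1`. For `g > 1` the log-square `Q(g) = {1 < x < g, 1 < y < g, slack}` is,
up to the wall `W = {x · y = g}`, the disjoint union of the log-triangle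
`T = {1 < x, 1 < y, x¹ y¹ < g, slack}` and the north-east triangle
`T' = {0 < x < g, y < g, g < x · y, slack}`:

* `T ⊆ Q`: `x, y > 1` and `xy < g` give `x < xy < g` and `y < xy < g`;
* `T' ⊆ Q`: `x > 0` and `xy > g > 0` force `y > 0`, then `y < g` gives `g < xy < xg`, i.e. `x > 1`,
  and symmetrically `y > 1`;
* `T ∩ T' = ∅` (`xy < g` versus `g < xy`), and `Q ∖ (T ∪ T') ⊆ W` by trichotomy.

The wall `W` is the zero set of the nonzero polynomial `X₀ X₁ − g`, hence Lebesgue-null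
(`MvPolynomial.volume_zeroSet_eq_zero`), so `[Q] − [T] − [T']` is a relation by
`lbc_of_sub_sub_mem_relations` (rule (1a) followed by a null modification).

Sources: Kontsevich–Zagier 2001, §1.2, rule (1).
-/

noncomputable section

open MeasureTheory Set MvPolynomial
open Literature.NumberTheory.Transcendental

namespace Summit.KontsevichZagierPeriods.SymplecticScissors.LogPolytope

/-! ## The hyperbolic wall is null -/

/-- The polynomial `X₀ X₁ − g ∈ ℝ[X₀, X₁, X₂]` is nonzero: it takes the value `1` at `(g + 1, 1, 0)`.
[folklore] -/
theorem sqs_X_mul_X_sub_C_ne_zero (g : ℝ) : (X 0 * X 1 - C g : MvPolynomial (Fin 3) ℝ) ≠ 0 := by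
  intro h
  have h1 := congrArg (MvPolynomial.eval (![g + 1, 1, 0] : Fin 3 → ℝ)) h
  simp only [map_sub, map_mul, eval_X, eval_C, map_zero, Matrix.cons_val_zero,
    Matrix.cons_val_one] at h1
  linarith

/-- The hyperbolic wall `{p | p 0 · p 1 = g}` in `ℝ³` is Lebesgue-null: it is the zero set of the
nonzero polynomial `X₀ X₁ − g`. [folklore] -/
theorem sqs_volume_wall_eq_zero (g : ℝ) : volume {p : Fin 3 → ℝ | p 0 * p 1 = g} = 0 := by
  have := MvPolynomial.volume_zeroSet_eq_zero 3 (X 0 * X 1 - C g) (sqs_X_mul_X_sub_C_ne_zero g)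
  simpa [sub_eq_zero] using this

/-! ## The stub -/

/-- **Stub (splitting the log-square along the hyperbola).** For `g > 1` the log-square
`{1 < x < g, 1 < y < g}` (with slack) is the disjoint union of the log-triangle `{x, y > 1, xy < g}`
and the north-east triangle `{0 < x < g, y < g, xy > g}` up to the null wall `xy = g`: rule (1a)
and a null modification (`lbc_of_sub_sub_mem_relations`). [folklore] -/
theorem stub_squareSplit : (∀ (g : ℝ), 1 < g → ∀ (r r₁ r₂ : KZ.IntegralRep 3), r.domain = {p : Fin 3 → ℝ | 1 < p 0 ∧ p 0 < g ∧ 1 < p 1 ∧ p 1 < g ∧ 0 < p 2 ∧ p 2 * (p 0 * p 1) < 1} → r₁.domain = {p : Fin 3 → ℝ | 1 < p 0 ∧ 1 < p 1 ∧ p 0 ^ 1 * p 1 ^ 1 < g ∧ 0 < p 2 ∧ p 2 * (p 0 * p 1) < 1} → r₂.domain = {p : Fin 3 → ℝ | 0 < p 0 ∧ p 0 < g ∧ p 1 < g ∧ g < p 0 * p 1 ∧ 0 < p 2 ∧ p 2 * (p 0 * p 1) < 1} → (∀ p ∈ r.domain, r.integrand p = 1) → (∀ p ∈ r₁.domain,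 r₁.integrand p = 1) → (∀ p ∈ r₂.domain, r₂.integrand p = 1) → KZ.of r - KZ.of r₁ - KZ.of r₂ ∈ KZ.relations) := by
  intro g hg r r₁ r₂ hr hr₁ hr₂ hri hr₁i hr₂i
  have hg0 : 0 < g := one_pos.trans hg
  refine lbc_of_sub_sub_mem_relations ?_ ?_ ?_ ?_ hri hr₁i hr₂i
  · -- `T ⊆ Q`
    rw [hr, hr₁]
    rintro p ⟨hx, hy, hxy, hz, hs⟩
    rw [pow_one, pow_one] at hxy
    have hprod : (p 0 - 1) * (p 1 - 1) > 0 := mul_pos (sub_pos.mpr hx) (sub_pos.mpr hy)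
    exact ⟨hx, by nlinarith, hy, by nlinarith, hz, hs⟩
  · -- `T' ⊆ Q`
    rw [hr, hr₂]
    rintro p ⟨hx0, hxg, hyg, hgxy, hz, hs⟩
    have hy0 : 0 < p 1 := by
      by_contra h
      have : p 0 * p 1 ≤ 0 := mul_nonpos_of_nonneg_of_nonpos hx0.le (not_lt.mp h)
      linarith
    have hx1 : 1 < p 0 := by
      have h1 : 1 * g < p 0 * g := by
        rw [one_mul]
        exact hgxy.trans (mul_lt_mul_of_pos_left hyg hx0)
      exact lt_of_mul_lt_mul_right h1 hg0.le
    have hy1 : 1 < p 1 := by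
      have h1 : g * 1 < g * p 1 := by
        rw [mul_one]
        exact hgxy.trans (mul_lt_mul_of_pos_right hxg hy0)
      exact lt_of_mul_lt_mul_left h1 hg0.le
    exact ⟨hx1, hxg, hy1, hyg, hz, hs⟩
  · -- the two pieces are disjoint (`xy < g` versus `g < xy`)
    rw [hr₁, hr₂]
    refine eq_empty_of_forall_notMem fun p hp => ?_
    obtain ⟨⟨-, -, hxy, -, -⟩, ⟨-, -, -, hgxy, -, -⟩⟩ := hp
    rw [pow_one, pow_one] at hxy
    exact lt_asymm hxy hgxy
  · -- the uncovered part lies in the null wall `xy = g`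
    rw [hr, hr₁, hr₂]
    refine measure_mono_null (fun p hp => ?_) (sqs_volume_wall_eq_zero g)
    obtain ⟨⟨hx, hxg, hy, hyg, hz, hs⟩, hnot⟩ := hp
    show p 0 * p 1 = g
    rcases lt_trichotomy (p 0 * p 1) g with hlt | heq | hgt
    · exact (hnot (Or.inl ⟨hx, hy, by rwa [pow_one, pow_one], hz, hs⟩)).elim
    · exact heq
    · exact (hnot (Or.inr ⟨one_pos.trans hx, hxg, hyg, hgt, hz, hs⟩)).elim

end Summit.KontsevichZagierPeriods.SymplecticScissors.LogPolytope

end
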